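import Summits.CriticalPhenomena.PercolationContinuityZ3.Theorems.PercNearOneGluingNoHeavyLowerTailSahiCombFiveUpSetRankZ3

/-!
# The two-copy certificate for `TRI_W(a)`: at `a = 1` the split (matroid-union) form holds by an EXPLICIT CLASS-LEVEL split

Support file of the one-cut programme (crux `NoHeavyLowerTail`, stmt-CriticalPhenomena-4575; TRI lane of cell `prim-masterthm`; seat prim-lf-1 gen 25;
memo `FROM-prim-lf-1-gen25-GF2-NOGO-AND-MATROID.md` §5; companion of `…SahiCombTriWCertificateClasses` (`SplitCert`, `triW_nonneg_of_split`)).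

`FiveUpSet.SplitCert` asks for a split of the demand tokens of the two-copy certificate into two ONE-copy-independent families plus a tag-matched
family of `K`-tokens.  At `a = 2` no CLASS-level split exists (memo §5: all `2⁸` assignments of the eight `L/R` classes fail on some `(n,a) = (2,2)`
instance even with every `K`-token free); at `a = 1` one does, and this file proves it.  With the thin edge presented by four up-sets
`F₀ ⊆ F₁`, `G₀ ⊆ G₁` of the cube (`F₀ = F 0`, `F₁ = F 1`), the six token classes are `L_0 = F₀ ∩ refl G₁`, `L_1 = F₁ ∩ refl G₀`, `R_0 = G₁ ∩ refl F₀`,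
`R_1 = G₀ ∩ refl F₁`, `K_0 = refl(F₀ ∩ G₀)`, `K_1 = refl(F₁ ∩ G₁)`, the supplies are `U₀ = F₀ ∩ G₀` (seen by the level-0 classes `L_0, R_0, K_0`) and
`U₁ = F₁ ∩ G₁` (seen by all), and the tags are `(0,d)` for `dᶜ ∈ F₀ ∩ G₁` (hitting `K_0` and `K_1` at `d`) and `(1,d)` for `dᶜ ∈ F₁ ∩ G₀` (hitting `K_1`).
THE SPLIT: copy A = `{L_1, R_0, K_1}`, copy B = `{L_0, R_1}`, `K_0` on tags only (and `K_1` keeps its tags).  The tags kill `K_0` and the non-shell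
part of `K_1`; copy A is then the RANK-Z family with the reflected shell seen by `U₁` only; copy B is two Kleitman classes.

* **`rankZ_kernel_eq_zero_shellTop`** — the variant of `rankZ_kernel_eq_zero` in which the shell class `S₃` is seen by the top supply `U₁` only
  (the level-0 equation involves `S₂` alone).  The proof is the tree proof of (RANK-Z) verbatim: its first step (`b₃ = 0`, antipodal coordinates at
  the shell indices) uses only the top equation.
* **`splitOne_kernel_eq_zero`** — the kernel form of the explicit `a = 1` split: the six coefficient vectors satisfying the two copy-A equations,
  the two copy-B equations and the two tag equations all vanish.  Hence `SplitCert` holds at `a = 1` (the transport to the index types of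
  `…TriWCertificate` is not done here; `TRI_W(1) ≥ 0` itself is `triW_nonneg_of_card_eq_one`).
HONEST LABEL: two unconditional kernel theorems at `a = 1`; nothing here is about `a ≥ 2`, where the split must divide at least three classes
token by token (memo §5). [this work]
-/

namespace Summit.CriticalPhenomena.PercolationContinuityZ3.Theorems

namespace FiveUpSet

open Finset

variable {α : Type} [DecidableEq α] [Fintype α]

/-- **(RANK-Z) with the shell at the top level only.**  `A₀ ⊆ A₁`, `B₀ ⊆ B₁` up-sets; `a` on `S₁ = {d ∈ A₁ : dᶜ ∈ B₀}`, `b₂` on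
`S₂ = {d ∈ B₁ : dᶜ ∈ A₀}`, `b₃` on `S₃ = {d : dᶜ ∈ (A₁ \ A₀) ∩ (B₁ \ B₀)}`; if `Z a + Z b₂ + Z b₃ = 0` on `A₁ ∩ B₁` and `Z b₂ = 0` on `A₀ ∩ B₀`
(NO condition on `b₃` there), then `a = b₂ = b₃ = 0`.  Proof = the proof of `rankZ_kernel_eq_zero` (gen 17/18), whose step `b₃ = 0` uses the top
equation only. [this work] -/
theorem rankZ_kernel_eq_zero_shellTop (A₀ A₁ B₀ B₁ : Finset (Finset α))
    (hA₀ : IsUpperSet (A₀ : Set (Finset α))) (hA₁ : IsUpperSet (A₁ : Set (Finset α)))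
    (hB₀ : IsUpperSet (B₀ : Set (Finset α))) (hB₁ : IsUpperSet (B₁ : Set (Finset α))) (hA : A₀ ⊆ A₁) (hB : B₀ ⊆ B₁)
    (a b₂ b₃ : Finset α → ℚ)
    (ha : ∀ d, a d ≠ 0 → d ∈ A₁ ∧ dᶜ ∈ B₀)
    (hb₂supp : ∀ d, b₂ d ≠ 0 → dᶜ ∈ A₀ ∧ d ∈ B₁)
    (hb₃supp : ∀ d, b₃ d ≠ 0 → dᶜ ∈ A₁ ∧ dᶜ ∉ A₀ ∧ dᶜ ∈ B₁ ∧ dᶜ ∉ B₀)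
    (h1 : ∀ t, t ∈ A₁ → t ∈ B₁ →
      ∑ d, a d * (if d ⊆ t then (1 : ℚ) else 0) + ∑ d, b₂ d * (if d ⊆ t then (1 : ℚ) else 0)
        + ∑ d, b₃ d * (if d ⊆ t then (1 : ℚ) else 0) = 0)
    (h2 : ∀ t, t ∈ A₀ → t ∈ B₀ → ∑ d, b₂ d * (if d ⊆ t then (1 : ℚ) else 0) = 0) :
    (∀ d, a d = 0) ∧ (∀ d, b₂ d = 0) ∧ (∀ d, b₃ d = 0) := by
  -- the big up-set `W = U₁ = A₁ ∩ B₁` and the small one `W₂ = U₂ = A₀ ∩ B₀`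
  have hW : IsUpperSet ((A₁ ∩ B₁ : Finset (Finset α)) : Set (Finset α)) := by
    rw [coe_inter]; exact hA₁.inter hB₁
  have hW₂ : IsUpperSet ((A₀ ∩ B₀ : Finset (Finset α)) : Set (Finset α)) := by
    rw [coe_inter]; exact hA₀.inter hB₀
  -- antipodal-basis coordinates of every zeta function on `W` (support lemma)
  choose c hcδ hcsupp hcid using fun d => exists_support_coef hW d
  -- the transfer identity: a combination of zeta functions, re-expanded in the coordinates, has the same values on `W`
  have transfer : ∀ (x : Finset α → ℚ), ∀ t ∈ A₁ ∩ B₁,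
      ∑ e, (∑ d, x d * c d e) * (if e ⊆ t then (1 : ℚ) else 0) = ∑ d, x d * (if d ⊆ t then (1 : ℚ) else 0) := by
    intro x t ht
    calc ∑ e, (∑ d, x d * c d e) * (if e ⊆ t then (1 : ℚ) else 0)
        = ∑ e, ∑ d, x d * (c d e * (if e ⊆ t then (1 : ℚ) else 0)) := by
          refine sum_congr rfl fun e _ => ?_
          rw [Finset.sum_mul]
          refine sum_congr rfl fun d _ => ?_
          ring
      _ = ∑ d, ∑ e, x d * (c d e * (if e ⊆ t then (1 : ℚ) else 0)) := Finset.sum_comm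
      _ = ∑ d, x d * ∑ e, c d e * (if e ⊆ t then (1 : ℚ) else 0) := by
          refine sum_congr rfl fun d _ => ?_
          rw [Finset.mul_sum]
      _ = ∑ d, x d * (if d ⊆ t then (1 : ℚ) else 0) := by
          refine sum_congr rfl fun d _ => ?_
          rw [← hcid d t ht]
  -- coordinate vectors of the three parts
  obtain ⟨Aco, hAco⟩ : ∃ f : Finset α → ℚ, ∀ e, f e = ∑ d, a d * c d e := ⟨_, fun _ => rfl⟩
  obtain ⟨Bco, hBco⟩ : ∃ f : Finset α → ℚ, ∀ e, f e = ∑ d, b₂ d * c d e := ⟨_, fun _ => rfl⟩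
  -- the `S₃`-part is its own coordinate vector (its sets have complements in `W`)
  have hB3co : ∀ e, ∑ d, b₃ d * c d e = b₃ e := by
    intro e
    have hterm : ∀ d, b₃ d * c d e = if e = d then b₃ e else 0 := by
      intro d
      by_cases h0 : b₃ d = 0
      · rw [h0, zero_mul]
        split_ifs with hed
        · rw [hed, h0]
        · rfl
      · have hdW : dᶜ ∈ A₁ ∩ B₁ := by
          obtain ⟨h1', -, h3', -⟩ := hb₃supp d h0
          exact mem_inter.2 ⟨h1', h3'⟩
        rw [hcδ d hdW]
        dsimp only
        split_ifs with hed
        · rw [hed, mul_one]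
        · rw [mul_zero]
    rw [Finset.sum_congr rfl fun d _ => hterm d, Finset.sum_ite_eq]
    simp
  -- supports of the coordinate vectors
  have hAsupp : ∀ e, Aco e ≠ 0 → eᶜ ∈ A₁ ∩ B₁ ∧ eᶜ ∈ B₀ := by
    intro e he
    rw [hAco e] at he
    obtain ⟨d, -, hd⟩ := Finset.exists_ne_zero_of_sum_ne_zero he
    have had : a d ≠ 0 := left_ne_zero_of_mul hd
    obtain ⟨heW, hed⟩ := hcsupp d e (right_ne_zero_of_mul hd)
    exact ⟨heW, hB₀ (Finset.compl_subset_compl.2 hed) (ha d had).2⟩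
  have hBsupp : ∀ e, Bco e ≠ 0 → eᶜ ∈ A₁ ∩ B₁ ∧ eᶜ ∈ A₀ := by
    intro e he
    rw [hBco e] at he
    obtain ⟨d, -, hd⟩ := Finset.exists_ne_zero_of_sum_ne_zero he
    have hbd : b₂ d ≠ 0 := left_ne_zero_of_mul hd
    obtain ⟨heW, hed⟩ := hcsupp d e (right_ne_zero_of_mul hd)
    exact ⟨heW, hA₀ (Finset.compl_subset_compl.2 hed) (hb₂supp d hbd).1⟩
  -- STEP (b): the first equation, read in antipodal coordinates on `W`, says `Aco + Bco + b₃ = 0`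
  have hrel : ∀ t ∈ A₁ ∩ B₁, ∑ e, (Aco e + Bco e + b₃ e) * (if e ⊆ t then (1 : ℚ) else 0) = 0 := by
    intro t ht
    have hsplit : ∑ e, (Aco e + Bco e + b₃ e) * (if e ⊆ t then (1 : ℚ) else 0)
        = ∑ d, a d * (if d ⊆ t then (1 : ℚ) else 0) + ∑ d, b₂ d * (if d ⊆ t then (1 : ℚ) else 0)
          + ∑ d, b₃ d * (if d ⊆ t then (1 : ℚ) else 0) := by
      have e3 : ∀ e, Aco e + Bco e + b₃ e = (∑ d, a d * c d e) + (∑ d, b₂ d * c d e) + (∑ d, b₃ d * c d e) := by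
        intro e; rw [hAco e, hBco e, hB3co e]
      simp only [e3, add_mul, Finset.sum_add_distrib]
      rw [transfer a t ht, transfer b₂ t ht, transfer b₃ t ht]
    rw [hsplit]
    exact h1 t (mem_inter.1 ht).1 (mem_inter.1 ht).2
  have hsum0 : ∀ e, Aco e + Bco e + b₃ e = 0 := by
    refine eq_zero_of_zeta_sum_eq_zero hW (fun e => Aco e + Bco e + b₃ e) ?_ hrel
    intro e he
    by_contra hW'
    have h1' : Aco e = 0 := by by_contra h; exact hW' (hAsupp e h).1
    have h2' : Bco e = 0 := by by_contra h; exact hW' (hBsupp e h).1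
    have h3' : b₃ e = 0 := by
      by_contra h
      obtain ⟨x1, -, x3, -⟩ := hb₃supp e h
      exact hW' (mem_inter.2 ⟨x1, x3⟩)
    apply he
    rw [h1', h2', h3']; ring
  -- `b₃ = 0`: at an `S₃`-index the other two coordinate vectors vanish
  have hb₃zero : ∀ e, b₃ e = 0 := by
    intro e
    by_contra hne
    obtain ⟨-, hnA₀, -, hnB₀⟩ := hb₃supp e hne
    have h1' : Aco e = 0 := by by_contra h; exact hnB₀ (hAsupp e h).2
    have h2' : Bco e = 0 := by by_contra h; exact hnA₀ (hBsupp e h).2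
    have h := hsum0 e
    rw [h1', h2', zero_add, zero_add] at h
    exact hne h
  -- `Aco = -Bco`, so `Aco` is supported on `refl (A₀ ∩ B₀)`
  have hAB : ∀ e, Aco e + Bco e = 0 := by
    intro e; have h := hsum0 e; rwa [hb₃zero e, add_zero] at h
  have hAsupp2 : ∀ e, Aco e ≠ 0 → eᶜ ∈ A₀ ∩ B₀ := by
    intro e he
    have hB : Bco e ≠ 0 := by
      intro h; apply he; have h' := hAB e; rwa [h, add_zero] at h'
    exact mem_inter.2 ⟨(hBsupp e hB).2, (hAsupp e he).2⟩
  -- STEP (c): on `U₂ = A₀ ∩ B₀` the `S₁`-part vanishes (first minus second equation); C1 on `U₂` kills `Aco`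
  have hAzero : ∀ e, Aco e = 0 := by
    refine eq_zero_of_zeta_sum_eq_zero hW₂ Aco hAsupp2 ?_
    intro t ht
    have htA₀ : t ∈ A₀ := (mem_inter.1 ht).1
    have htB₀ : t ∈ B₀ := (mem_inter.1 ht).2
    have htW : t ∈ A₁ ∩ B₁ := mem_inter.2 ⟨hA htA₀, hB htB₀⟩
    rw [Finset.sum_congr rfl fun e _ => by rw [hAco e], transfer a t htW]
    have e1 := h1 t (hA htA₀) (hB htB₀)
    have e3 : ∑ d, b₃ d * (if d ⊆ t then (1 : ℚ) else 0) = 0 :=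
      Finset.sum_eq_zero fun d _ => by rw [hb₃zero d, zero_mul]
    rwa [h2 t htA₀ htB₀, e3, add_zero, add_zero] at e1
  -- STEP (d): the `S₁`-combination vanishes on `W`, hence on all of `B₀`; C1 on `B₀` gives `a = 0`
  have hazero : ∀ d, a d = 0 := by
    refine eq_zero_of_zeta_sum_eq_zero hB₀ a (fun d hd => (ha d hd).2) ?_
    intro t htB₀
    by_cases htA₁ : t ∈ A₁
    · have htW : t ∈ A₁ ∩ B₁ := mem_inter.2 ⟨htA₁, hB htB₀⟩
      rw [← transfer a t htW]
      refine Finset.sum_eq_zero fun e _ => ?_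
      rw [← hAco e, hAzero e, zero_mul]
    · refine Finset.sum_eq_zero fun d _ => ?_
      by_cases hd : a d = 0
      · rw [hd, zero_mul]
      · have hdt : ¬ d ⊆ t := fun h => htA₁ (hA₁ h (ha d hd).1)
        rw [if_neg hdt, mul_zero]
  -- and symmetrically `Bco = 0`, so the `S₂`-combination vanishes on `W`, hence on `A₀`; C1 on `A₀` gives `b₂ = 0`
  have hBzero : ∀ e, Bco e = 0 := by
    intro e; have h := hAB e; rwa [hAzero e, zero_add] at h
  have hb₂zero : ∀ d, b₂ d = 0 := by
    refine eq_zero_of_zeta_sum_eq_zero hA₀ b₂ (fun d hd => (hb₂supp d hd).1) ?_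
    intro t htA₀
    by_cases htB₁ : t ∈ B₁
    · have htW : t ∈ A₁ ∩ B₁ := mem_inter.2 ⟨hA htA₀, htB₁⟩
      rw [← transfer b₂ t htW]
      refine Finset.sum_eq_zero fun e _ => ?_
      rw [← hBco e, hBzero e, zero_mul]
    · refine Finset.sum_eq_zero fun d _ => ?_
      by_cases hd : b₂ d = 0
      · rw [hd, zero_mul]
      · have hdt : ¬ d ⊆ t := fun h => htB₁ (hB₁ h (hb₂supp d hd).2)
        rw [if_neg hdt, mul_zero]
  exact ⟨hazero, hb₂zero, hb₃zero⟩

/-- **The explicit `a = 1` split (kernel form): `SplitCert` holds at `a = 1`.**  Four up-sets `F₀ ⊆ F₁`, `G₀ ⊆ G₁`; coefficient vectors `b0` on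
`L_0 = F₀ ∩ refl G₁`, `b1` on `L_1 = F₁ ∩ refl G₀`, `g1` on `R_0 = G₁ ∩ refl F₀`, `g0` on `R_1 = G₀ ∩ refl F₁`, `k0` on `K_0 = refl(F₀ ∩ G₀)`, `k1` on
`K_1 = refl(F₁ ∩ G₁)`.  The token-gauge two-copy certificate with copy A = `{L_1, R_0, K_1}`, copy B = `{L_0, R_1}`, `K_0` tag-only has the equations:
copy A, fibre 0 (`t ∈ F₀ ∩ G₀`): `Z g1 = 0`; copy A, fibre 1 (`t ∈ F₁ ∩ G₁`): `Z b1 + Z g1 + Z k1 = 0`; copy B, fibre 0: `Z b0 = 0`; copy B, fibre 1: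
`Z b0 + Z g0 = 0`; tags `(0,d)`, `dᶜ ∈ F₀ ∩ G₁`: `k0 d + k1 d = 0`; tags `(1,d)`, `dᶜ ∈ F₁ ∩ G₀`: `k1 d = 0`.  If they hold, all six vectors vanish.
Proof: the tags kill `k0` and leave `k1` supported on the reflected shell; copy A is then `rankZ_kernel_eq_zero_shellTop`; copy B is two C2′ steps. [this work] -/
theorem splitOne_kernel_eq_zero (F₀ F₁ G₀ G₁ : Finset (Finset α))
    (hF₀ : IsUpperSet (F₀ : Set (Finset α))) (hF₁ : IsUpperSet (F₁ : Set (Finset α)))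
    (hG₀ : IsUpperSet (G₀ : Set (Finset α))) (hG₁ : IsUpperSet (G₁ : Set (Finset α))) (hF : F₀ ⊆ F₁) (hG : G₀ ⊆ G₁)
    (b0 b1 g1 g0 k0 k1 : Finset α → ℚ)
    (sb0 : ∀ d, b0 d ≠ 0 → d ∈ F₀ ∧ dᶜ ∈ G₁) (sb1 : ∀ d, b1 d ≠ 0 → d ∈ F₁ ∧ dᶜ ∈ G₀)
    (sg1 : ∀ d, g1 d ≠ 0 → d ∈ G₁ ∧ dᶜ ∈ F₀) (sg0 : ∀ d, g0 d ≠ 0 → d ∈ G₀ ∧ dᶜ ∈ F₁)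
    (sk0 : ∀ d, k0 d ≠ 0 → dᶜ ∈ F₀ ∧ dᶜ ∈ G₀) (sk1 : ∀ d, k1 d ≠ 0 → dᶜ ∈ F₁ ∧ dᶜ ∈ G₁)
    (cA0 : ∀ t, t ∈ F₀ → t ∈ G₀ → zsum g1 t = 0)
    (cA1 : ∀ t, t ∈ F₁ → t ∈ G₁ → zsum b1 t + zsum g1 t + zsum k1 t = 0)
    (cB0 : ∀ t, t ∈ F₀ → t ∈ G₀ → zsum b0 t = 0)
    (cB1 : ∀ t, t ∈ F₁ → t ∈ G₁ → zsum b0 t + zsum g0 t = 0)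
    (tg0 : ∀ d, dᶜ ∈ F₀ → dᶜ ∈ G₁ → k0 d + k1 d = 0)
    (tg1 : ∀ d, dᶜ ∈ F₁ → dᶜ ∈ G₀ → k1 d = 0) :
    (∀ d, b0 d = 0) ∧ (∀ d, b1 d = 0) ∧ (∀ d, g1 d = 0) ∧ (∀ d, g0 d = 0) ∧ (∀ d, k0 d = 0) ∧ (∀ d, k1 d = 0) := by
  -- tags: `k0 = 0`, and `k1` lives on the reflected shell
  have hk0 : ∀ d, k0 d = 0 := by
    intro d
    by_contra hne
    obtain ⟨hdF, hdG⟩ := sk0 d hne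
    have h1 := tg1 d (hF hdF) hdG
    have h0 := tg0 d hdF (hG hdG)
    rw [h1, add_zero] at h0
    exact hne h0
  have hk1supp : ∀ d, k1 d ≠ 0 → dᶜ ∈ F₁ ∧ dᶜ ∉ F₀ ∧ dᶜ ∈ G₁ ∧ dᶜ ∉ G₀ := by
    intro d hne
    obtain ⟨hdF, hdG⟩ := sk1 d hne
    refine ⟨hdF, fun hdF0 => ?_, hdG, fun hdG0 => hne (tg1 d hdF hdG0)⟩
    have h0 := tg0 d hdF0 hdG
    rw [hk0 d, zero_add] at h0
    exact hne h0
  -- copy A: RANK-Z with the shell at the top level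
  have hA := rankZ_kernel_eq_zero_shellTop F₀ F₁ G₀ G₁ hF₀ hF₁ hG₀ hG₁ hF hG b1 g1 k1 sb1
    (fun d hd => ⟨(sg1 d hd).2, (sg1 d hd).1⟩) hk1supp
    (fun t htF htG => by have h := cA1 t htF htG; unfold zsum at h; exact h)
    (fun t htF htG => by have h := cA0 t htF htG; unfold zsum at h; exact h)
  obtain ⟨hb1, hg1, hk1⟩ := hA
  -- copy B: two C2′ steps
  have ng0 : ∀ t, t ∉ G₀ → zsum g0 t = 0 := fun t ht => zsum_eq_zero_of_not_mem hG₀ g0 (fun d hd => (sg0 d hd).1) ht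
  have hb0 : ∀ d, b0 d = 0 := by
    refine eq_zero_of_zsum_eq_zero_on hF₀ hG₁ b0 sb0 fun t htF htG => ?_
    by_cases ht0 : t ∈ G₀
    · exact cB0 t htF ht0
    · have h := cB1 t (hF htF) htG
      rw [ng0 t ht0, add_zero] at h
      exact h
  have zb0 : ∀ t, zsum b0 t = 0 := by
    intro t; unfold zsum; exact Finset.sum_eq_zero fun d _ => by rw [hb0 d, zero_mul]
  have hg0 : ∀ d, g0 d = 0 := by
    refine eq_zero_of_zsum_eq_zero_on hG₀ hF₁ g0 sg0 fun t htG htF => ?_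
    have h := cB1 t htF (hG htG)
    rw [zb0 t, zero_add] at h
    exact h
  exact ⟨hb0, hb1, hg1, hg0, hk0, hk1⟩

end FiveUpSet

end Summit.CriticalPhenomena.PercolationContinuityZ3.Theorems
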